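import Literature.Probability.RandomPlanarGeometry.SAWBridges
import Literature.Probability.RandomPlanarGeometry.SupercriticalSAWPolygons
import Literature.Probability.Percolation.LatticeSymmetry
import HarnessLib

/-!
# `bₙ ≤ μⁿ` (Madras–Slade (1.2.17)) and the identification of the two bridge counts

Topic `Literature/Probability/RandomPlanarGeometry`. The tree carries two models of the bridges of
`ℤ²`: the Walk-based, vertical bridges `IsBridge`/`bridgeCount n = bₙ` of
`SupercriticalSAWPolygons.lean` (the `bₙ` of the named fact `DKY2014_eq21`, the Hammersley–Welsh
bound `e^{-c√n}μⁿ ≤ bₙ ≤ μⁿ` quoted as eq. (2.1) by Duminil-Copin–Kozma–Yadin 2014), and the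
vertex-function, horizontal bridges `Zd.IsBridge`/`Zd.bridgeCount d n` of `SAWBridges.lean`
(Madras–Slade, Def. 1.2.4), for which supermultiplicativity `b_m b_n ≤ b_{m+n}`
(`Zd.bridgeCount_mul_le`, Madras–Slade (1.2.15)) is proved. This file

* identifies the two: **`bridgeCount_eq_zd : bridgeCount n = Zd.bridgeCount 2 n`** (transpose the
  axes with `transposeIso` and pass to vertex functions with `Walk.getVert`; a self-avoiding walk
  revisits `0` only at time `0`, so "`w = 0 ∨ 0 < y(w) ≤ y(v)` on the support" is
  "`0 < ω₁(i) ≤ ω₁(n)` for `1 ≤ i ≤ n`");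
* proves **`bₙ ≤ μⁿ`** in both models (`Zd.bridgeCount_le_pow`, `bridgeCount_le_pow`): from
  `bₙᵏ ≤ b_{kn} ≤ c_{kn}` (`Zd.bridgeCount_pow_le`), `bₙ ≤ (c_{kn}^{1/kn})ⁿ → μⁿ` as `k → ∞`
  (`Zd.tendsto_count_rpow`, Fekete) — Madras–Slade (1.2.17): "`b_N ≤ μ_{Bridge}^N ≤ μ^N`";
* hence reduces `DKY2014_eq21` to its lower half, the Hammersley–Welsh bound proper
  (`DKY2014_eq21_of_lowerBound`).

Sources: N. Madras, G. Slade, *The Self-Avoiding Walk* (1993), §1.2, (1.2.15)–(1.2.17);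
H. Duminil-Copin, G. Kozma, A. Yadin (2014), §2, eq. (2.1).
-/

noncomputable section

open Filter Topology SimpleGraph Literature.Probability.LatticeModels Literature.Probability.Percolation
open scoped BigOperators

namespace Literature.Probability.RandomPlanarGeometry.SAW

/-! ### `bₙᵏ ≤ b_{kn}` and `bₙ ≤ μⁿ` in the vertex-function model -/

namespace Zd

variable {d : ℕ} [NeZero d]

/-- `bₙᵏ ≤ b_{kn}`: concatenate `k` bridges (`bridgeCount_mul_le` iterated).
[cite: MadrasSlade1993, §1.2, eq. (1.2.15)] -/
theorem bridgeCount_pow_le (n k : ℕ) : bridgeCount d n ^ k ≤ bridgeCount d (k * n) := by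
  induction k with
  | zero => simpa using one_le_bridgeCount (d := d) 0
  | succ k ih =>
    calc bridgeCount d n ^ (k + 1) = bridgeCount d n ^ k * bridgeCount d n := pow_succ _ _
      _ ≤ bridgeCount d (k * n) * bridgeCount d n := Nat.mul_le_mul_right _ ih
      _ ≤ bridgeCount d (k * n + n) := bridgeCount_mul_le _ _
      _ = bridgeCount d ((k + 1) * n) := by rw [Nat.succ_mul]

/-- **`bₙ ≤ μⁿ`** (Madras–Slade (1.2.17): "`b_N ≤ μ_{Bridge}^N ≤ μ^N`"): from `bₙᵏ ≤ b_{kn} ≤ c_{kn}`,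
`bₙ ≤ (c_{kn}^{1/(kn)})ⁿ`, and `c_m^{1/m} → μ` (Fekete, `tendsto_count_rpow`).
[cite: MadrasSlade1993, §1.2, eq. (1.2.17)] -/
theorem bridgeCount_le_pow (n : ℕ) : (bridgeCount d n : ℝ) ≤ connectiveConstant d ^ n := by
  rcases Nat.eq_zero_or_pos n with rfl | hn
  · -- `b₀ = 1 = μ⁰`
    have h1 : bridgeCount d 0 ≤ 1 := (bridgeCount_le_count 0).trans (count_zero d).le
    have h2 : 1 ≤ bridgeCount d 0 := one_le_bridgeCount 0
    have : bridgeCount d 0 = 1 := le_antisymm h1 h2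
    simp [this]
  -- along `k ↦ kn`, `(c_{kn}^{1/(kn)})ⁿ → μⁿ`, and each term is `≥ bₙ`
  have hsub : Tendsto (fun k : ℕ => k * n) atTop atTop :=
    tendsto_id.atTop_mul_const' hn
  have hlim : Tendsto (fun k : ℕ => ((count d (k * n) : ℝ) ^ (1 / ((k * n : ℕ) : ℝ))) ^ n) atTop
      (𝓝 (connectiveConstant d ^ n)) :=
    ((tendsto_count_rpow d).comp hsub).pow n
  refine ge_of_tendsto hlim ?_
  filter_upwards [eventually_ge_atTop 1] with k hk
  have hkn : (k * n : ℕ) ≠ 0 := Nat.mul_ne_zero (by omega) hn.ne'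
  have hb0 : (0 : ℝ) ≤ bridgeCount d n := Nat.cast_nonneg _
  have hc0 : (0 : ℝ) ≤ count d (k * n) := Nat.cast_nonneg _
  -- `bₙ = (bₙ^{kn... }` : compare `k n`-th powers
  have hpow : ((bridgeCount d n : ℝ)) ^ (k * n) ≤
      (((count d (k * n) : ℝ) ^ (1 / ((k * n : ℕ) : ℝ))) ^ n) ^ (k * n) := by
    have h1 : ((bridgeCount d n : ℝ)) ^ (k * n) = ((bridgeCount d n : ℝ) ^ k) ^ n := by
      rw [← pow_mul]
    have h2 : (((count d (k * n) : ℝ) ^ (1 / ((k * n : ℕ) : ℝ))) ^ n) ^ (k * n) =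
        (count d (k * n) : ℝ) ^ n := by
      rw [← pow_mul, mul_comm n (k * n), pow_mul, one_div, Real.rpow_inv_natCast_pow hc0 hkn]
    rw [h1, h2]
    refine pow_le_pow_left₀ (pow_nonneg hb0 _) ?_ n
    exact_mod_cast (bridgeCount_pow_le n k).trans (bridgeCount_le_count (k * n))
  exact le_of_pow_le_pow_left₀ hkn (pow_nonneg (Real.rpow_nonneg hc0 _) _) hpow

end Zd

/-! ### The vertical Walk-bridges of `ℤ²` are the horizontal vertex-function bridges -/

section Identification

/-- The transport: transpose the axes and pass to the vertex function of the walk.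
[cite: MadrasSlade1993, Definition 1.2.4] -/
def bridgeFun {v : Site 2} (p : (zdGraph 2).Walk (0 : Site 2) v) : ℕ → Site 2 :=
  fun i => transposeIso (p.getVert i)

/-- Coordinates of the transported function: `(bridgeFun p i)₀ = (p i)₁`. [folklore] -/
@[simp] theorem bridgeFun_apply_zero {v : Site 2} (p : (zdGraph 2).Walk (0 : Site 2) v) (i : ℕ) :
    bridgeFun p i 0 = p.getVert i 1 := by
  simp [bridgeFun]

/-- The transported function of an `n`-step self-avoiding walk to `v` is an `n`-step
self-avoiding vertex function to the transposed endpoint. [folklore] -/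
theorem bridgeFun_mem_sawFun {n : ℕ} {v : Site 2} {p : (zdGraph 2).Walk (0 : Site 2) v}
    (hlen : p.length = n) (hp : p.IsPath) : bridgeFun p ∈ Zd.sawFun 2 n (transposeIso v) := by
  rw [Zd.mem_sawFun]
  refine ⟨by simp [bridgeFun], fun i hi => ?_, fun i hi => ?_, fun i hi j hj hij => ?_⟩
  · simp only [bridgeFun, p.getVert_of_length_le (hlen ▸ hi)]
  · exact (transposeIso.map_rel_iff).2 (p.adj_getVert_succ (hlen ▸ hi))
  · have hinj := hp.getVert_injOn
    rw [hlen] at hinj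
    exact hinj hi hj (RelIso.injective transposeIso hij)

/-- A vertical bridge is transported to a horizontal bridge: a self-avoiding walk is at `0` only
at time `0`. [cite: MadrasSlade1993, Definition 1.2.4] -/
theorem isBridge_bridgeFun {n : ℕ} {v : Site 2} {p : (zdGraph 2).Walk (0 : Site 2) v}
    (hlen : p.length = n) (hb : IsBridge p) : Zd.IsBridge n (bridgeFun p) := by
  intro i h1 hi
  simp only [bridgeFun_apply_zero, Walk.getVert_zero, Pi.zero_apply,
    p.getVert_of_length_le (le_of_eq hlen)]
  rcases hb.2 _ (p.getVert_mem_support i) with h0 | h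
  · -- `p i = 0 = p 0` forces `i = 0`
    have hinj := hb.1.getVert_injOn
    have : i = 0 := hinj (by rw [Set.mem_setOf_eq, hlen]; exact hi) (by simp)
      (h0.trans p.getVert_zero.symm)
    omega
  · exact h

/-- Walks of equal length with the same transported function are equal. [folklore] -/
theorem bridgeFun_injective {v : Site 2} {p q : (zdGraph 2).Walk (0 : Site 2) v}
    (h : bridgeFun p = bridgeFun q) : p = q :=
  Walk.ext_getVert fun k => RelIso.injective transposeIso (congrFun h k)

/-- Every horizontal bridge (vertex function) is the transport of a vertical Walk-bridge.
[cite: MadrasSlade1993, Definition 1.2.4] -/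
theorem exists_bridgeFun_eq {n : ℕ} {v : Site 2} {ω : ℕ → Site 2}
    (hω : ω ∈ Zd.sawFun 2 n (transposeIso v)) (hb : Zd.IsBridge n ω) :
    ∃ p : (zdGraph 2).Walk (0 : Site 2) v, p.length = n ∧ IsBridge p ∧ bridgeFun p = ω := by
  classical
  obtain ⟨h0, hend, hadj, hinj⟩ := Zd.mem_sawFun.1 hω
  -- the transposed function traces a walk of `ℤ²` from `0` to `v`
  set ω' : ℕ → Site 2 := fun i => transposeIso (ω i) with hω'
  have hadj' : ∀ i < n, (zdGraph 2).Adj (ω' i) (ω' (i + 1)) := fun i hi =>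
    (transposeIso.map_rel_iff).2 (hadj i hi)
  have h0' : ω' 0 = 0 := by simp [hω', h0]
  -- `transposeIso` is an involution (`transposeIso_symm_apply`)
  have hinv : ∀ x : Site 2, transposeIso (transposeIso x) = x := fun x => by
    rw [← transposeIso_symm_apply, RelIso.symm_apply_apply]
  have hn' : ω' n = v := by
    simp only [hω', hend n le_rfl, hinv]
  refine ⟨(Zd.walkOfFn ω' n hadj').copy h0' hn', by simp, ⟨?_, fun w hw => ?_⟩, ?_⟩
  · -- self-avoiding
    rw [← Walk.IsPath.getVert_injOn_iff]
    intro i hi j hj hij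
    simp only [Set.mem_setOf_eq, Walk.length_copy, Zd.length_walkOfFn] at hi hj
    simp only [Walk.getVert_copy, Zd.getVert_walkOfFn, min_eq_left hi, min_eq_left hj, hω'] at hij
    exact hinj hi hj (RelIso.injective transposeIso hij)
  · -- vertical bridge
    rw [Walk.mem_support_iff_exists_getVert] at hw
    obtain ⟨i, rfl, hi⟩ := hw
    simp only [Walk.length_copy, Zd.length_walkOfFn] at hi
    simp only [Walk.getVert_copy, Zd.getVert_walkOfFn, min_eq_left hi]
    rcases Nat.eq_zero_or_pos i with rfl | hpos
    · exact Or.inl h0'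
    · right
      have := hb i hpos hi
      rw [h0, hend n le_rfl] at this
      simpa [hω', transposeIso_apply] using this
  · funext i
    simp only [bridgeFun, Walk.getVert_copy, Zd.getVert_walkOfFn, hω']
    rcases le_or_gt i n with hi | hi
    · rw [min_eq_left hi, hinv]
    · rw [min_eq_right hi.le, hend n le_rfl, hend i hi.le, hinv]

open Classical in
/-- Termwise identification: the `n`-step vertical Walk-bridges to `v` are equinumerous with the
`n`-step horizontal vertex-function bridges to the transposed endpoint.
[cite: MadrasSlade1993, Definition 1.2.4] -/
theorem card_filter_isBridge_eq (n : ℕ) (v : Site 2) :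
    (((zdGraph 2).finsetWalkLength n (0 : Site 2) v).filter fun p => IsBridge p).card =
      ((Zd.sawFun 2 n (transposeIso v)).filter fun ω => Zd.IsBridge n ω).card := by
  classical
  refine Finset.card_nbij bridgeFun (fun p hp => ?_) (fun p hp q hq h => bridgeFun_injective h)
    (fun ω hω => ?_)
  · rw [Finset.mem_coe, Finset.mem_filter, mem_finsetWalkLength_iff] at hp
    rw [Finset.mem_coe, Finset.mem_filter]
    exact ⟨bridgeFun_mem_sawFun hp.1 hp.2.1, isBridge_bridgeFun hp.1 hp.2⟩
  · rw [Finset.mem_coe, Finset.mem_filter] at hω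
    obtain ⟨p, hlen, hb, rfl⟩ := exists_bridgeFun_eq hω.1 hω.2
    exact ⟨p, by rw [Finset.mem_coe, Finset.mem_filter, mem_finsetWalkLength_iff]; exact ⟨hlen, hb⟩,
      rfl⟩

/-- **The two bridge counts of the tree agree**: `bridgeCount n` (vertical Walk-bridges of
`SupercriticalSAWPolygons.lean`, the `bₙ` of `DKY2014_eq21`) equals `Zd.bridgeCount 2 n`
(horizontal vertex-function bridges of `SAWBridges.lean`). [cite: MadrasSlade1993, Definition 1.2.4] -/
theorem bridgeCount_eq_zd (n : ℕ) : bridgeCount n = Zd.bridgeCount 2 n := by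
  classical
  -- right-hand side as a sum over endpoints
  have hdisj : (↑(box 2 n) : Set (Site 2)).PairwiseDisjoint fun x =>
      (Zd.sawFun 2 n x).filter fun ω => Zd.IsBridge n ω := by
    intro x _ y _ hxy
    refine Finset.disjoint_left.2 fun ω hx hy => hxy ?_
    have hx' := (Zd.mem_sawFun.1 (Finset.mem_filter.1 hx).1).2.1 n le_rfl
    have hy' := (Zd.mem_sawFun.1 (Finset.mem_filter.1 hy).1).2.1 n le_rfl
    exact hx'.symm.trans hy'
  have hR : Zd.bridgeCount 2 n =
      ∑ x ∈ box 2 n, ((Zd.sawFun 2 n x).filter fun ω => Zd.IsBridge n ω).card := by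
    rw [Zd.bridgeCount, Zd.bridges, Zd.saws, Finset.filter_biUnion, Finset.card_biUnion hdisj]
  -- left-hand side, reindexed by the transposition (which preserves the box)
  have hinj : Set.InjOn (fun v : Site 2 => transposeIso v) ↑(box 2 n) :=
    fun _ _ _ _ h => RelIso.injective transposeIso h
  have himage : (box 2 n).image (fun v : Site 2 => transposeIso v) = box 2 n := by
    apply Finset.coe_injective
    rw [Finset.coe_image]
    exact signedPerm_image_box _ _ n
  rw [hR, ← himage, Finset.sum_image hinj]
  unfold bridgeCount
  exact Finset.sum_congr rfl fun v _ => card_filter_isBridge_eq n v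

end Identification

/-! ### `bₙ ≤ μⁿ` for the bridges of `DKY2014_eq21`, and (2.1) from its lower half -/

/-- **`bₙ ≤ μⁿ`** for the Walk-bridges of `ℤ²` and `μ = connectiveConstant`: the upper bound in
"`e^{-c√n}μⁿ ≤ bₙ ≤ μⁿ`". [cite: DuminilCopinKozmaYadin2014, §2, eq. (2.1)] -/
theorem bridgeCount_le_pow (n : ℕ) : (bridgeCount n : ℝ) ≤ connectiveConstant ^ n := by
  rw [bridgeCount_eq_zd, ← Zd.connectiveConstant_two]
  exact Zd.bridgeCount_le_pow n

/-- The Hammersley–Welsh bound (2.1), `DKY2014_eq21`, follows from its lower half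
`∃ c, ∀ n, e^{-c√n} μⁿ ≤ bₙ` (the unfolding theorem of Hammersley–Welsh, Madras–Slade Cor. 3.1.6),
the upper half being `bridgeCount_le_pow`. [cite: DuminilCopinKozmaYadin2014, §2, eq. (2.1)] -/
theorem DKY2014_eq21_of_lowerBound
    (h : ∃ c : ℝ, ∀ n : ℕ,
      Real.exp (-(c * Real.sqrt n)) * connectiveConstant ^ n ≤ bridgeCount n) :
    DKY2014_eq21 := by
  obtain ⟨c, hc⟩ := h
  exact ⟨c, fun n => ⟨hc n, bridgeCount_le_pow n⟩⟩

end Literature.Probability.RandomPlanarGeometry.SAW
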